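import Literature.AlgebraicGeometry.AbelianVarieties.FourierMukaiExchangeTensor
import Literature.AlgebraicGeometry.Modules.ProjectionFormulaLocallyFree
import HarnessLib

/-!
# Mukai's exchange of translation and `⊗ Pic⁰` for the DERIVED Fourier functor:
# `RŜ ∘ D⁺(t_x^*) ≅ D⁺(P_{x⁻¹} ⊗ –) ∘ RŜ` on `D⁺(Mod 𝒪_A)` (Mukai 1981 (3.1), first row; Lange Prop. 6.1.16 (b))

Layer `Literature/AlgebraicGeometry/AbelianVarieties`; sequel to `FourierMukaiExchangeTensor` (the second row). For a
principally polarised complex abelian variety `(A, Θ)` (`Â = A.dualOf Θ hΘ`, Poincaré sheaf `𝒫`, `P_x = 𝒫|_{{x} × Â}` =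
`linePtHat A hΘ hK x` on `Â`) and `RŜ = fourierMukaiPlus A hΘ hK`, this file PROVES (0 named facts, no instances) the
first row of Mukai's (3.1) as an isomorphism of FUNCTORS `D⁺(Mod 𝒪_A) ⥤ D⁺(Mod 𝒪_Â)`:

  `D⁺(t_x^*) ⋙ RŜ ≅ RŜ ⋙ D⁺(P_{x⁻¹} ⊗ –)`     (`fourierMukaiPlusExchangeTranslationIso`),

"`RS ∘ T_x̂^* ≅ (⊗ P_{−x̂}) ∘ RS`". Ingredients: §1 the automorphism `e = t_x × 1 = t_{(x,1)}` of `A × Â` with its squares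
`e ≫ p_A = p_A ≫ t_x`, `e ≫ p_Â = p_Â`, and the translation formula at `(x,1)⁻¹ = (x⁻¹, 1)` in `tensorObj` currency,
`e⁻¹^*𝒫 ≅ 𝒫 ⊗ p_Â^*P_{x⁻¹}` (from the tree's class identity `pullback_prodTranslation_detClass_poincareSheaf`); §2 the NATURAL
isomorphism of kernel functors on ALL of `Mod(𝒪_A)`, `t_x^* ⋙ (𝒫 ⊗ p_A^*(–)) ≅ (𝒫 ⊗ p_A^*(–)) ⋙ (p_Â^*P_{x⁻¹} ⊗ –) ⋙ e^*`
(`Modules/PullbackTensorOfLocallyFree`, associator ∕ braiding, Mathlib `pullbackComp`); §3 the DERIVED PROJECTION FORMULA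
`D⁺(p_Â^*L ⊗ –) ⋙ Rp_{Â*} ≅ Rp_{Â*} ⋙ D⁺(L ⊗ –)` for a line bundle `L` on `Â` (`Modules/ProjectionFormulaLocallyFree` — the
module-level formula for ARBITRARY modules — applied through `Algebra/Homology/RightDerivedFunctorPlusComp`: `p_Â^*L ⊗ –` is an
exact auto-equivalence, hence preserves injectives); §4 the row: `D⁺` of §2, `D⁺(e^*) ⋙ Rp_{Â*} ≅ Rp_{Â*}`
(`Modules/DerivedPushforwardIsoBaseChange`), and §3.

NOT here: compatibility with composition of translations ∕ with the second row; Mukai's Thm. 2.2; the displayed module-level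
row `Mukai1981_exchangeTranslation` (objectwise, underived, right tensoring) is neither used nor discharged. Typed for the
cell `pub-hodge-ring2` (plate P4 ROW 1 of the (M1) library debt of crux 26512); a research route conditional on HC_CM, not a
corollary — nothing in this file refers to it.

## References

* S. Mukai, *Duality between `D(X)` and `D(X̂)`…*, Nagoya Math. J. 81 (1981), §3 (3.1) p. 158 (`RS ∘ T_x̂^* ≅ (⊗ P_{−x̂}) ∘ RS`).
  [Mukai1981]
* H. Lange, *Abelian Varieties over the Complex Numbers* (2023), Lemma 6.1.3, Prop. 6.1.16 (b) (`(t_x^*ℱ)^ ≃ ℱ̂ ⊗ P_{−x}`).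
  [Lange2023AbelianVarietiesComplex]
* R. Hartshorne, *Algebraic Geometry* (1977), II Ex. 5.1 (d) (projection formula), III Prop. 9.3. [Hartshorne1977]
-/

noncomputable section

-- `TopCat.Presheaf`/`Scheme.Modules` are not reducible (as in Mathlib's `AlgebraicGeometry/Modules/Sheaf.lean`).
set_option backward.isDefEq.respectTransparency false

open CategoryTheory CategoryTheory.Limits AlgebraicGeometry MonoidalCategory CartesianMonoidalCategory
open AlgebraicGeometry.Scheme.Modules

universe w₁ w₂ w₃ u

namespace Literature.AlgebraicGeometry.AbelianVarieties

open Literature.AlgebraicGeometry.Motives Literature.AlgebraicGeometry.Modules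
open scoped MonObj

variable (A : AbelianVariety ℂ) {Θ : CartierDivisor A.X.left} (hΘ : Θ.IsAmple) (hK : A.KTheta Θ = ⊥)

/-! ### §1 The automorphism `t_x × 1` of `A × Â` and `(t_x × 1)⁻¹^*𝒫 ≅ 𝒫 ⊗ p_Â^*P_{x⁻¹}` -/

section Point

variable (x : A.Points ℂ)

/-- The complex point `(x, 1)` of `A × Â`. [cite: Mukai1981, §3 p. 158 L6] -/
def prodUnitPoint : (A.prod (A.dualOf Θ hΘ)).Points ℂ :=
  lift x (1 : (A.dualOf Θ hΘ).Points ℂ)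

/-- `(x, 1) ≫ p_A = x`. [cite: Mukai1981, §3 p. 158 L6] -/
@[simp]
theorem prodUnitPoint_comp_fst : prodUnitPoint A hΘ x ≫ fst A.X (A.dualOf Θ hΘ).X = x := lift_fst _ _

/-- `(x, 1) ≫ p_Â = 1`. [cite: Mukai1981, §3 p. 158 L6] -/
@[simp]
theorem prodUnitPoint_comp_snd : prodUnitPoint A hΘ x ≫ snd A.X (A.dualOf Θ hΘ).X = 1 := lift_snd _ _

/-- `(x, 1)⁻¹ ≫ p_A = x⁻¹` (the projection is a homomorphism). [cite: GortzWedhorn2023, Def./Rem. 27.1 (p. 799)] -/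
theorem prodUnitPoint_inv_comp_fst : (prodUnitPoint A hΘ x)⁻¹ ≫ fst A.X (A.dualOf Θ hΘ).X = x⁻¹ := by
  rw [GrpObj.inv_comp, prodUnitPoint_comp_fst]

/-- `(x, 1)⁻¹ ≫ p_Â = 1`. [cite: GortzWedhorn2023, Def./Rem. 27.1 (p. 799)] -/
theorem prodUnitPoint_inv_comp_snd : (prodUnitPoint A hΘ x)⁻¹ ≫ snd A.X (A.dualOf Θ hΘ).X = 1 := by
  rw [GrpObj.inv_comp, prodUnitPoint_comp_snd, inv_one]

/-- **The automorphism `t_x × 1 = t_{(x,1)}` of the scheme `A × Â`.** [cite: Mukai1981, §3 p. 158 L6]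
[cite: Lange2023AbelianVarietiesComplex, §6.1.1 Lemma 6.1.3] -/
def translationProdUnitIso : (A.X ⊗ (A.dualOf Θ hΘ).X).left ≅ (A.X ⊗ (A.dualOf Θ hΘ).X).left :=
  (Over.forget _).mapIso ((A.prod (A.dualOf Θ hΘ)).translationIso (prodUnitPoint A hΘ x))

/-- The translation `t_x` of `A` as an isomorphism of schemes. [cite: GortzWedhorn2023, Def./Rem. 27.1 (p. 799)] -/
def translationSchemeIso : A.X.left ≅ A.X.left :=
  (Over.forget _).mapIso (A.translationIso x)

/-- `(t_x × 1).hom = t_{(x,1)}` on underlying schemes (unfolding). [cite: Mukai1981, §3 p. 158 L6] -/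
theorem translationProdUnitIso_hom :
    (translationProdUnitIso A hΘ x).hom = (prodTranslation A (A.dualOf Θ hΘ) (prodUnitPoint A hΘ x)).left := rfl

/-- `(t_x × 1).inv = t_{(x,1)⁻¹}` on underlying schemes (unfolding). [cite: Mukai1981, §3 p. 158 L6] -/
theorem translationProdUnitIso_inv :
    (translationProdUnitIso A hΘ x).inv = (prodTranslation A (A.dualOf Θ hΘ) (prodUnitPoint A hΘ x)⁻¹).left := rfl

/-- **`(t_x × 1) ≫ p_A = p_A ≫ t_x`.** [cite: Mukai1981, §3 p. 158 L6] -/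
theorem translationProdUnitIso_hom_comp_fst :
    (translationProdUnitIso A hΘ x).hom ≫ (fst A.X (A.dualOf Θ hΘ).X).left =
      (fst A.X (A.dualOf Θ hΘ).X).left ≫ (translationSchemeIso A x).hom := by
  rw [translationProdUnitIso_hom, ← Over.comp_left, prodTranslation_comp_fst, prodUnitPoint_comp_fst, Over.comp_left]
  rfl

/-- **`(t_x × 1) ≫ p_Â = p_Â`** (as the square `p_Â ≫ 𝟙 = (t_x × 1) ≫ p_Â` over which `Rp_{Â*}` is base-changed).
[cite: Mukai1981, §3 p. 158 L6] -/
theorem snd_comp_refl_hom :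
    (snd A.X (A.dualOf Θ hΘ).X).left ≫ (Iso.refl (A.dualOf Θ hΘ).X.left).hom =
      (translationProdUnitIso A hΘ x).hom ≫ (snd A.X (A.dualOf Θ hΘ).X).left := by
  rw [Iso.refl_hom, Category.comp_id, translationProdUnitIso_hom, ← Over.comp_left, prodTranslation_comp_snd,
    prodUnitPoint_comp_snd, AbelianVariety.translation_one, Category.comp_id]

/-- `(t_x × 1)^*` is left exact. [cite: Hartshorne1977, II §5 p. 110] -/
theorem preservesFiniteLimits_pullback_translationProdUnit :
    PreservesFiniteLimits (Scheme.Modules.pullback (translationProdUnitIso A hΘ x).hom) :=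
  preservesFiniteLimits_pullback_of_iso _

/-- `t_x^*` is left exact. [cite: Hartshorne1977, II §5 p. 110] -/
theorem preservesFiniteLimits_pullback_translationScheme :
    PreservesFiniteLimits (Scheme.Modules.pullback (translationSchemeIso A x).hom) :=
  preservesFiniteLimits_pullback_of_iso _

/-- `P_{x⁻¹} ⊗ –` (on `Â`) is left exact (a line bundle is invertible). [cite: StacksProject, Tag 0B8M] -/
theorem preservesFiniteLimits_tensor_linePtHat (y : A.Points ℂ) :
    PreservesFiniteLimits ((tensorBifunctor (A.dualOf Θ hΘ).X.left).obj (linePtHat A hΘ hK y)) :=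
  (isInvertibleModule_of_hasRank_one (isFiniteLocallyFree_linePtHat A hΘ hK y) (hasRank_linePtHat A hΘ hK y)).preservesFiniteLimits

/-- `P_{x⁻¹} ⊗ –` is right exact. [cite: StacksProject, Tag 0B8M] -/
theorem preservesFiniteColimits_tensor_linePtHat (y : A.Points ℂ) :
    PreservesFiniteColimits ((tensorBifunctor (A.dualOf Θ hΘ).X.left).obj (linePtHat A hΘ hK y)) :=
  (isInvertibleModule_of_hasRank_one (isFiniteLocallyFree_linePtHat A hΘ hK y) (hasRank_linePtHat A hΘ hK y)).preservesFiniteColimits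

/-- `P_{x⁻¹} ⊗ –` is additive. [cite: StacksProject, Tag 01CA] -/
theorem additive_tensor_linePtHat (y : A.Points ℂ) :
    ((tensorBifunctor (A.dualOf Θ hΘ).X.left).obj (linePtHat A hΘ hK y)).Additive :=
  additive_tensorBifunctor_obj _

/-- **The translation formula at `(x, 1)⁻¹` in `tensorObj` currency: `(t_x × 1)⁻¹^*𝒫 ≅ 𝒫 ⊗ p_Â^*P_{x⁻¹}`** (both line bundles
with class `[𝒫]·p_A^*[P_1]·p_Â^*[P̂_{x⁻¹}] = [𝒫]·p_Â^*[P̂_{x⁻¹}]`). [cite: Lange2023AbelianVarietiesComplex, §6.1.1 Lemma 6.1.3]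
[cite: Mukai1981, §3 p. 158 L6–8] -/
theorem nonempty_pullback_translationProdUnit_inv_poincareSheaf_iso :
    Nonempty ((Scheme.Modules.pullback (translationProdUnitIso A hΘ x).inv).obj (poincareSheaf A hΘ hK) ≅
      tensorObj (poincareSheaf A hΘ hK)
        ((Scheme.Modules.pullback (snd A.X (A.dualOf Θ hΘ).X).left).obj (linePtHat A hΘ hK x⁻¹))) := by
  have h𝒫 := isFiniteLocallyFree_poincareSheaf A hΘ hK
  have h𝒫₁ := hasRank_poincareSheaf A hΘ hK
  have hP := isFiniteLocallyFree_linePtHat A hΘ hK x⁻¹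
  have hP₁ := hasRank_linePtHat A hΘ hK x⁻¹
  refine (nonempty_iso_iff_detClass_eq (hasRank_pullback _ h𝒫₁)
    (hasRank_tensorObj_one h𝒫₁ (hasRank_pullback _ hP₁)) (h𝒫.pullback _)
    (isFiniteLocallyFree_tensorObj _ _ h𝒫 (hP.pullback _))).2 ?_
  rw [detClass_pullback _ h𝒫, detClass_tensorObj_of_hasRank_one h𝒫₁ (hasRank_pullback _ hP₁) h𝒫 (hP.pullback _),
    detClass_pullback _ hP, translationProdUnitIso_inv, pullback_prodTranslation_detClass_poincareSheaf,
    prodUnitPoint_inv_comp_snd, prodUnitPoint_inv_comp_fst, detClass_linePt_one, map_one, mul_one]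

/-- A chosen isomorphism `(t_x × 1)⁻¹^*𝒫 ≅ 𝒫 ⊗ p_Â^*P_{x⁻¹}`. [cite: Mukai1981, §3 p. 158 L6–8] -/
def pullbackTranslationProdUnitInvPoincareSheafIso :
    (Scheme.Modules.pullback (translationProdUnitIso A hΘ x).inv).obj (poincareSheaf A hΘ hK) ≅
      tensorObj (poincareSheaf A hΘ hK)
        ((Scheme.Modules.pullback (snd A.X (A.dualOf Θ hΘ).X).left).obj (linePtHat A hΘ hK x⁻¹)) :=
  (nonempty_pullback_translationProdUnit_inv_poincareSheaf_iso A hΘ hK x).some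

end Point

/-! ### §2 The exchange isomorphism of kernel functors `t_x^* ⋙ (𝒫 ⊗ p_A^*(–)) ≅ (𝒫 ⊗ p_A^*(–)) ⋙ (p_Â^*P_{x⁻¹} ⊗ –) ⋙ (t_x × 1)^*` -/

section Kernel

variable (x : A.Points ℂ)

/-- `t_x^* ⋙ p_A^* ≅ p_A^* ⋙ (t_x × 1)^*` from `(t_x × 1) ≫ p_A = p_A ≫ t_x` (Mathlib `pullbackComp`, `pullbackCongr`).
[cite: Mukai1981, §3 p. 158 L6] -/
def pullbackTranslationCompFstIso :
    Scheme.Modules.pullback (translationSchemeIso A x).hom ⋙ Scheme.Modules.pullback (fst A.X (A.dualOf Θ hΘ).X).left ≅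
      Scheme.Modules.pullback (fst A.X (A.dualOf Θ hΘ).X).left ⋙ Scheme.Modules.pullback (translationProdUnitIso A hΘ x).hom :=
  pullbackComp _ _ ≪≫ pullbackCongr (translationProdUnitIso_hom_comp_fst A hΘ x).symm ≪≫ (pullbackComp _ _).symm

/-- `𝒫 ≅ (t_x × 1)^*((t_x × 1)⁻¹^*𝒫)` (an automorphism followed by its inverse). [folklore] -/
def poincareSheafIsoPullbackPullbackInv :
    poincareSheaf A hΘ hK ≅ (Scheme.Modules.pullback (translationProdUnitIso A hΘ x).hom).obj
      ((Scheme.Modules.pullback (translationProdUnitIso A hΘ x).inv).obj (poincareSheaf A hΘ hK)) :=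
  ((pullbackComp (translationProdUnitIso A hΘ x).hom (translationProdUnitIso A hΘ x).inv ≪≫
      pullbackCongr (translationProdUnitIso A hΘ x).hom_inv_id ≪≫ pullbackId _).app (poincareSheaf A hΘ hK)).symm

/-- `((L ⊗ Q) ⊗ –) ≅ (L ⊗ –) ⋙ (Q ⊗ –)` (braiding then associator: `(L ⊗ Q) ⊗ N ≅ Q ⊗ (L ⊗ N)`), natural in `N`.
[cite: StacksProject, Tag 01CA (Lemma 17.16.1)] -/
def tensorLeftTensorIsoComp {X : Scheme} (L Q : X.Modules) :
    (tensorBifunctor X).obj (tensorObj L Q) ≅ (tensorBifunctor X).obj L ⋙ (tensorBifunctor X).obj Q :=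
  (tensorBifunctor X).mapIso (tensorComm L Q) ≪≫ (tensorLeftCompIso Q L).symm

/-- **The exchange isomorphism of kernel functors, natural on ALL of `Mod(𝒪_A)`**:
`𝒫 ⊗ p_A^*(t_x^*M) ≅ (t_x × 1)^*(p_Â^*P_{x⁻¹} ⊗ (𝒫 ⊗ p_A^*M))`, naturally in `M`. [cite: Mukai1981, §3 p. 158 L1–9]
[cite: Lange2023AbelianVarietiesComplex, §6.1.1 Lemma 6.1.3] -/
def kernelExchangeTranslationNatIso :
    Scheme.Modules.pullback (translationSchemeIso A x).hom ⋙
        integralKernelFunctor (fst A.X (A.dualOf Θ hΘ).X).left (poincareSheaf A hΘ hK) ≅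
      integralKernelFunctor (fst A.X (A.dualOf Θ hΘ).X).left (poincareSheaf A hΘ hK) ⋙
        (tensorBifunctor _).obj ((Scheme.Modules.pullback (snd A.X (A.dualOf Θ hΘ).X).left).obj (linePtHat A hΘ hK x⁻¹)) ⋙
        Scheme.Modules.pullback (translationProdUnitIso A hΘ x).hom :=
  let p := (fst A.X (A.dualOf Θ hΘ).X).left
  let e := translationProdUnitIso A hΘ x
  let Pc := poincareSheaf A hΘ hK
  let Q := (Scheme.Modules.pullback (snd A.X (A.dualOf Θ hΘ).X).left).obj (linePtHat A hΘ hK x⁻¹)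
  let h𝒫' : IsFiniteLocallyFree ((Scheme.Modules.pullback e.inv).obj Pc) := (isFiniteLocallyFree_poincareSheaf A hΘ hK).pullback _
  -- `t_x^* ⋙ p^* ⋙ (𝒫 ⊗ –) ≅ p^* ⋙ e^* ⋙ (𝒫 ⊗ –)`
  (Functor.associator _ _ _).symm ≪≫
    Functor.isoWhiskerRight (pullbackTranslationCompFstIso A hΘ x) _ ≪≫
    Functor.associator _ _ _ ≪≫
    -- `≅ p^* ⋙ e^* ⋙ (e^*(e⁻¹^*𝒫) ⊗ –) ≅ p^* ⋙ (e⁻¹^*𝒫 ⊗ –) ⋙ e^* ≅ p^* ⋙ ((𝒫 ⊗ Q) ⊗ –) ⋙ e^*`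
    Functor.isoWhiskerLeft (Scheme.Modules.pullback p)
      (Functor.isoWhiskerLeft (Scheme.Modules.pullback e.hom)
          ((tensorBifunctor _).mapIso (poincareSheafIsoPullbackPullbackInv A hΘ hK x)) ≪≫
        (pullbackTensorNatIsoOfLeft e.hom h𝒫').symm ≪≫
        Functor.isoWhiskerRight ((tensorBifunctor _).mapIso (pullbackTranslationProdUnitInvPoincareSheafIso A hΘ hK x) ≪≫
          tensorLeftTensorIsoComp Pc Q) (Scheme.Modules.pullback e.hom) ≪≫
        Functor.associator _ _ _) ≪≫
    (Functor.associator _ _ _).symm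

end Kernel

/-! ### §3 The derived projection formula for a line bundle on `Â` -/

section DerivedProjection

variable {P Y : Scheme.{u}} (q : P ⟶ Y) {L : Y.Modules}

/-- `q^*L ⊗ –` carries injectives to injectives for `L` a line bundle (it is an auto-equivalence of `Mod(𝒪_P)`, right adjoint
to its quasi-inverse). [cite: StacksProject, Tag 0B8M] -/
theorem injective_tensor_pullback_obj (hL : IsFiniteLocallyFree L) (hL₁ : HasRank L 1) (I : P.Modules) (hI : Injective I) :
    Injective (((tensorBifunctor P).obj ((Scheme.Modules.pullback q).obj L)).obj I) := by
  haveI := hI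
  haveI := (isInvertibleModule_of_hasRank_one (hL.pullback q) (hasRank_pullback q hL₁)).isEquivalence
  exact Injective.injective_of_adjoint
    ((tensorBifunctor P).obj ((Scheme.Modules.pullback q).obj L)).asEquivalence.symm.toAdjunction I

/-- **The DERIVED projection formula for a line bundle: `D⁺(q^*L ⊗ –) ⋙ Rq_* ≅ Rq_* ⋙ D⁺(L ⊗ –)`** on `D⁺(Mod 𝒪_P)`:
`q^*L ⊗ –` is exact and preserves injectives, so `Rq_*` may be computed after it
(`Functor.rightDerivedFunctorPlusExactCompIso`); the module-level projection formula `(q^*L ⊗ –) ⋙ q_* ≅ q_* ⋙ (L ⊗ –)`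
(`Modules/ProjectionFormulaLocallyFree.projectionFormulaNatIso`, ARBITRARY modules — in particular injective ones); and the
exact `L ⊗ –` comes out of `R` (`Functor.rightDerivedFunctorPlusCompExactIso`). Exactness instances are binders.
[cite: Hartshorne1977, II Ex. 5.1 (d) and III Ex. 8.3 (projection formula for higher direct images)] -/
def derivedProjectionFormulaIso [HasDerivedCategory.{w₂} P.Modules] [HasDerivedCategory.{w₃} Y.Modules]
    (hL : IsFiniteLocallyFree L) (hL₁ : HasRank L 1) [((tensorBifunctor P).obj ((Scheme.Modules.pullback q).obj L)).Additive]
    [PreservesFiniteLimits ((tensorBifunctor P).obj ((Scheme.Modules.pullback q).obj L))]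
    [PreservesFiniteColimits ((tensorBifunctor P).obj ((Scheme.Modules.pullback q).obj L))]
    [((tensorBifunctor Y).obj L).Additive] [PreservesFiniteLimits ((tensorBifunctor Y).obj L)]
    [PreservesFiniteColimits ((tensorBifunctor Y).obj L)] :
    ((tensorBifunctor P).obj ((Scheme.Modules.pullback q).obj L)).mapDerivedCategoryPlus ⋙ derivedPushforwardPlus q ≅
      derivedPushforwardPlus q ⋙ ((tensorBifunctor Y).obj L).mapDerivedCategoryPlus :=
  ((tensorBifunctor P).obj ((Scheme.Modules.pullback q).obj L)).rightDerivedFunctorPlusExactCompIso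
      (injective_tensor_pullback_obj q hL hL₁) (pushforward q) ≪≫
    Functor.rightDerivedFunctorPlusIsoOfIso _ _ (projectionFormulaNatIso q hL) ≪≫
    ((pushforward q).rightDerivedFunctorPlusCompExactIso ((tensorBifunctor Y).obj L)).symm

end DerivedProjection

/-! ### §4 The derived row: `D⁺(t_x^*) ⋙ RŜ ≅ RŜ ⋙ D⁺(P_{x⁻¹} ⊗ –)` -/

section Derived

variable (x : A.Points ℂ) [HasDerivedCategory.{w₁} A.X.left.Modules]
  [HasDerivedCategory.{w₂} (A.X ⊗ (A.dualOf Θ hΘ).X).left.Modules]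
  [HasDerivedCategory.{w₃} (A.dualOf Θ hΘ).X.left.Modules]

/-- **MUKAI'S EXCHANGE OF TRANSLATION AND `⊗ Pic⁰` FOR THE DERIVED FOURIER FUNCTOR (first row of (3.1)):
`D⁺(t_x^*) ⋙ RŜ ≅ RŜ ⋙ D⁺(P_{x⁻¹} ⊗ –)`** as functors `D⁺(Mod 𝒪_A) ⥤ D⁺(Mod 𝒪_Â)` — for every bounded-below complex `E•`,
`RŜ(t_x^*E•) ≅ P_{x⁻¹} ⊗ RŜ(E•)`, naturally ("`RS ∘ T_x̂^* ≅ (⊗ P_{−x̂}) ∘ RS`"). Proof: `D⁺` of the kernel exchange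
`kernelExchangeTranslationNatIso`, then `D⁺((t_x × 1)^*) ⋙ Rp_{Â*} ≅ Rp_{Â*}` (base change along `(t_x × 1) ≫ p_Â = p_Â`),
then the derived projection formula for `P_{x⁻¹}`. The exactness instances of `t_x^*` and `P_{x⁻¹} ⊗ –` in the statement are
binders (discharge with §1's theorems). [cite: Mukai1981, §3 (3.1) p. 158 (RS ∘ T_x̂^* ≅ (⊗ P_{−x̂}) ∘ RS)]
[cite: Lange2023AbelianVarietiesComplex, Prop. 6.1.16 (b)] -/
def fourierMukaiPlusExchangeTranslationIso [PreservesFiniteLimits (Scheme.Modules.pullback (translationSchemeIso A x).hom)]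
    [((tensorBifunctor (A.dualOf Θ hΘ).X.left).obj (linePtHat A hΘ hK x⁻¹)).Additive]
    [PreservesFiniteLimits ((tensorBifunctor (A.dualOf Θ hΘ).X.left).obj (linePtHat A hΘ hK x⁻¹))]
    [PreservesFiniteColimits ((tensorBifunctor (A.dualOf Θ hΘ).X.left).obj (linePtHat A hΘ hK x⁻¹))] :
    (Scheme.Modules.pullback (translationSchemeIso A x).hom).mapDerivedCategoryPlus ⋙ fourierMukaiPlus A hΘ hK ≅
      fourierMukaiPlus A hΘ hK ⋙
        ((tensorBifunctor (A.dualOf Θ hΘ).X.left).obj (linePtHat A hΘ hK x⁻¹)).mapDerivedCategoryPlus := by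
  haveI := preservesFiniteLimits_pullback_fst A hΘ
  haveI := preservesFiniteLimits_tensor_poincareSheaf A hΘ hK
  haveI := preservesFiniteColimits_tensor_poincareSheaf A hΘ hK
  haveI := additive_integralKernelFunctor (fst A.X (A.dualOf Θ hΘ).X).left (poincareSheaf A hΘ hK)
  haveI := preservesFiniteLimits_integralKernelFunctor (fst A.X (A.dualOf Θ hΘ).X).left (poincareSheaf A hΘ hK)
  haveI := preservesFiniteColimits_integralKernelFunctor (fst A.X (A.dualOf Θ hΘ).X).left (poincareSheaf A hΘ hK)
  haveI := preservesFiniteLimits_pullback_translationProdUnit A hΘ x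
  let q := (snd A.X (A.dualOf Θ hΘ).X).left
  let L := linePtHat A hΘ hK x⁻¹
  have hL : IsFiniteLocallyFree L := isFiniteLocallyFree_linePtHat A hΘ hK x⁻¹
  have hL₁ : HasRank L 1 := hasRank_linePtHat A hΘ hK x⁻¹
  let T := (tensorBifunctor (A.X ⊗ (A.dualOf Θ hΘ).X).left).obj ((Scheme.Modules.pullback q).obj L)
  haveI : T.Additive := additive_tensorBifunctor_obj _
  haveI : PreservesFiniteLimits T :=
    (isInvertibleModule_of_hasRank_one (hL.pullback q) (hasRank_pullback q hL₁)).preservesFiniteLimits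
  haveI : PreservesFiniteColimits T :=
    (isInvertibleModule_of_hasRank_one (hL.pullback q) (hasRank_pullback q hL₁)).preservesFiniteColimits
  haveI := preservesFiniteLimits_pushforward_inv_of_iso (translationProdUnitIso A hΘ x)
  haveI := preservesFiniteColimits_pushforward_inv_of_iso (translationProdUnitIso A hΘ x)
  let G := integralKernelFunctor (fst A.X (A.dualOf Θ hΘ).X).left (poincareSheaf A hΘ hK)
  let tx := Scheme.Modules.pullback (translationSchemeIso A x).hom
  let e := Scheme.Modules.pullback (translationProdUnitIso A hΘ x).hom
  -- `D⁺(e^*) ⋙ Rq_* ≅ D⁺((e⁻¹)_*) ⋙ Rq_* ≅ R(e⁻¹ ≫ q)_* ≅ Rq_*`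
  have h : (translationProdUnitIso A hΘ x).hom ≫ q = q := by
    simpa only [Iso.refl_hom, Category.comp_id] using (snd_comp_refl_hom A hΘ x).symm
  have w : (translationProdUnitIso A hΘ x).inv ≫ q = q := by
    calc (translationProdUnitIso A hΘ x).inv ≫ q = (translationProdUnitIso A hΘ x).inv ≫ (translationProdUnitIso A hΘ x).hom ≫ q := by
          rw [h]
      _ = q := by rw [Iso.inv_hom_id_assoc]
  let bc : e.mapDerivedCategoryPlus ⋙ derivedPushforwardPlus q ≅ derivedPushforwardPlus q :=
    Functor.isoWhiskerRight (Functor.mapDerivedCategoryPlusIsoOfIso _ _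
        (pullbackIsoPushforwardInv (translationProdUnitIso A hΘ x))) _ ≪≫
      derivedPushforwardPlusIsoCompIso (translationProdUnitIso A hΘ x).symm q ≪≫
      Functor.rightDerivedFunctorPlusIsoOfIso _ _ (pushforwardCongr w)
  -- `D⁺(tx) ⋙ D⁺(G) ⋙ Rq_* ≅ D⁺(tx ⋙ G) ⋙ Rq_* ≅ D⁺(G ⋙ T ⋙ e) ⋙ Rq_* ≅ D⁺(G) ⋙ D⁺(T) ⋙ (D⁺(e) ⋙ Rq_*) ≅ … ≅ D⁺(G) ⋙ Rq_* ⋙ D⁺(L ⊗ –)`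
  exact (Functor.associator _ _ _).symm ≪≫
    Functor.isoWhiskerRight ((Functor.mapDerivedCategoryPlusCompIso tx G).symm ≪≫
      Functor.mapDerivedCategoryPlusIsoOfIso _ _ (kernelExchangeTranslationNatIso A hΘ hK x) ≪≫
      Functor.mapDerivedCategoryPlusCompIso G (T ⋙ e) ≪≫
      Functor.isoWhiskerLeft G.mapDerivedCategoryPlus (Functor.mapDerivedCategoryPlusCompIso T e))
      (derivedPushforwardPlus q) ≪≫
    Functor.associator _ _ _ ≪≫
    Functor.isoWhiskerLeft G.mapDerivedCategoryPlus
      (Functor.associator _ _ _ ≪≫ Functor.isoWhiskerLeft T.mapDerivedCategoryPlus bc ≪≫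
        derivedProjectionFormulaIso q hL hL₁) ≪≫
    (Functor.associator _ _ _).symm

/-- **Objectwise form**: `RŜ(Q(t_x^*E•)) ≅ P_{x⁻¹} ⊗ RŜ(Q E•)` for every `E ∈ D⁺(Mod 𝒪_A)` (components of
`fourierMukaiPlusExchangeTranslationIso`, instances discharged). [cite: Mukai1981, §3 (3.1) p. 158]
[cite: Lange2023AbelianVarietiesComplex, Prop. 6.1.16 (b)] -/
theorem nonempty_fourierMukaiPlus_translation_iso (E : DerivedCategory.Plus A.X.left.Modules) :
    Nonempty ((fourierMukaiPlus A hΘ hK).obj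
        ((haveI := preservesFiniteLimits_pullback_translationScheme A x
          (Scheme.Modules.pullback (translationSchemeIso A x).hom).mapDerivedCategoryPlus).obj E) ≅
      (haveI := additive_tensor_linePtHat A hΘ hK x⁻¹
       haveI := preservesFiniteLimits_tensor_linePtHat A hΘ hK x⁻¹
       haveI := preservesFiniteColimits_tensor_linePtHat A hΘ hK x⁻¹
       ((tensorBifunctor (A.dualOf Θ hΘ).X.left).obj (linePtHat A hΘ hK x⁻¹)).mapDerivedCategoryPlus).obj
        ((fourierMukaiPlus A hΘ hK).obj E)) :=
  haveI := preservesFiniteLimits_pullback_translationScheme A x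
  haveI := additive_tensor_linePtHat A hΘ hK x⁻¹
  haveI := preservesFiniteLimits_tensor_linePtHat A hΘ hK x⁻¹
  haveI := preservesFiniteColimits_tensor_linePtHat A hΘ hK x⁻¹
  ⟨(fourierMukaiPlusExchangeTranslationIso A hΘ hK x).app E⟩

end Derived

end Literature.AlgebraicGeometry.AbelianVarieties

end
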